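import Literature.NumberTheory.GaloisRepresentations.IdeleClassGroupLimitAction
import Literature.Algebra.Homology.DiscreteRepLayerTransition
import Mathlib.FieldTheory.Galois.Infinite
import Mathlib.FieldTheory.AbsoluteGaloisGroup
import Mathlib.RepresentationTheory.Homological.GroupCohomology.Functoriality
import HarnessLib

/-!
# `C̄ = lim→ C_E` in the category `C_Γ` of discrete `Γ_F`-modules, and its LAYERS: `C̄^{Gal(F̄/E)} ≅ C_E` as
# representations, and `Hⁿ(Γ_F ⧸ Gal(F̄/E), C̄^{Gal(F̄/E)}) ≅ Hⁿ(Gal(E/F), C_E)`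
# (Harari, *Galois Cohomology and CFT* §13.1; Serre, *Galois Cohomology* I §2.2; Tate, C–F VII §11.1)

Topic `NumberTheory/GaloisRepresentations`; namespace `Literature.NumberTheory.GaloisRepresentations.IdeleClassBar`.
Sequel to `IdeleClassGroupLimit.lean` / `IdeleClassGroupLimitAction.lean` (door-c5 g15: `GalLayer F`, `classBar F`,
`ofLayer`, `barRep`, `setOf_forall_mem_fixingSubgroup_eq_range`).  Definitions with bodies and theorems; NO named fact,
no `sorry`, no instance, no notation; number fields in `Type`; `Γ_F = Field.absoluteGaloisGroup F`
(`= AlgebraicClosure F ≃ₐ[F] AlgebraicClosure F` with the Krull topology, Mathlib).  Written for Route A of the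
Poitou–Tate programme of crux `AnticycControlAdditiveK` (cell bsd-schneider, item 19295): it PLUGS the idèle class
formation at finite layers (`IdeleClassInvariant*.lean`, `IdeleInflation.lean`: `classInvAll F E`, `classInf F E E'`) into
door-c4's colimit theorem `Extⁿ_{C_Γ}(ℤ, M) = lim→_U Extⁿ_{Rep ℤ (Γ⧸U)}(ℤ, M^U)` (`DiscreteRepLayerColimit.lean`, layers
`(DiscreteRep.invariantsQuotFunctor ℤ U).obj M` indexed by `OpenNormalSubgroup Γ`, transitions
`DiscreteRep.invariantsStepIncl` along `DiscreteRep.quotMap`).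

Mathematics.  `C̄` is a discrete `Γ_F`-module (every element comes from a layer `C_E`, fixed by the open subgroup
`U_E = Gal(F̄/E)`), i.e. an object of Harari's `C_Γ` (§4.2).  By infinite Galois theory (Mathlib
`InfiniteGalois.fixedField_fixingSubgroup` / `fixingSubgroup_fixedField`, `isOpen_iff_finite`,
`IsGalois.of_fixedField_normal_subgroup`; `F̄/F` is Galois as `F` has characteristic zero) the finite Galois layers
`E ⊆ F̄` correspond to the open normal subgroups `U ≤ Γ_F`, `E ↦ U_E`, `U ↦ F̄^U`, reversing inclusions, with
`Γ_F ⧸ U_E ≃* Gal(E/F)` (`[σ] ↦ σ|_E`).  Under this dictionary the layer `C̄^{U_E}` of door-c4's system is `C_E`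
(`H⁰(Gal(F̄/E), C̄) = C_E`, g15), equivariantly along `Γ_F ⧸ U_E ≃* Gal(E/F)`, whence (Mathlib `groupCohomology.mapIso`)
`Hⁿ(Γ_F ⧸ U_E, C̄^{U_E}) ≅ Hⁿ(Gal(E/F), C_E)`; and for `E ≤ E'` the transition `Hⁿ(quotMap, incl) : Hⁿ(Γ⧸U_E, C̄^{U_E}) →
Hⁿ(Γ⧸U_{E'}, C̄^{U_{E'}})` of door-c4's system is the INFLATION `classInf F E E' n` of the cell (Serre I §2.2 Prop. 8: `Hq(G, A) = lim→ Hq(G/U, A^U)`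
along the inflations; Tate VII §11.1: passage to the limit over the finite layers `E ⊆ K̄`).

The compatibility of door-c4's transitions `Hⁿ(quotMap, incl)` with the cell's inflations `classInf F E E' n` is the
sequel file `IdeleClassGroupLimitInflation.lean`.

## What is formalised (`F : Type` a number field, `Γ = absoluteGaloisGroup F`)

* §7 the dictionary: `GalLayer.fixingSubgroup_normal`, **`GalLayer.openNormalSubgroup E`** (`U_E = Gal(F̄/E)`),
  `openNormalSubgroup_le_iff` (`U_{E'} ≤ U_E ↔ E ≤ E'`), `coe_openNormalSubgroup_le`, **`GalLayer.ofOpenNormalSubgroup U`**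
  (`F̄^U`), `openNormalSubgroup_ofOpenNormalSubgroup`, `ofOpenNormalSubgroup_openNormalSubgroup`,
  **`layerEquivOpenNormalSubgroup : GalLayer F ≃o (OpenNormalSubgroup Γ)ᵒᵈ`**, **`GalLayer.quotEquiv E :
  Γ ⧸ U_E ≃* Gal(E/F)`** (+ `quotEquiv_mk`, `quotEquiv_symm_restrictNormal`).
* §8 `classBarRep F : Rep ℤ Γ` (`= Rep.of (barRep F)`), `fixingSubgroup_le_stabilizer_ofLayer`,
  **`isDiscrete_classBarRep`**, **`classBarD F : DiscreteRepCat ℤ Γ`** (the object `C̄` of `C_Γ`), `layerRep E`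
  (door-c4's layer `(invariantsQuotFunctor ℤ U_E).obj (classBarD F) = C̄^{U_E}` as a `Γ ⧸ U_E`-representation).
* §9 the layer module: `mem_invariants_iff` (`C̄^{U_E} = range ofLayer`), `toInvariantsHom`, **`layerEquiv E :
  (C̄^{U_E}) ≃ₗ[ℤ] C_E`** (+ `coe_layerEquiv_symm`, `coe_layerEquiv`' `ofLayer_layerEquiv`, `layerEquiv_eq_iff`,
  `layerEquiv_ρ_mk`, `layerEquiv_comm` = equivariance along `quotEquiv`), **`layerEquiv_invariantsStepIncl`** (the
  inclusion `C̄^{U_E} ⊆ C̄^{U_{E'}}` is g15's transition `transHom E E'`).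
* §10 **`layerCohomologyIso E n : Hⁿ(Γ ⧸ U_E, C̄^{U_E}) ≅ Hⁿ(Gal(E/F), C_E)`** (`groupCohomology.mapIso`).

## References
* D. Harari, *Galois Cohomology and Class Field Theory*, Universitext, Springer (2020), §4.2 (discrete modules `C_G`),
  §13.1 (`C = lim→ C_K`). [Harari2020]
* J.-P. Serre, *Galois Cohomology*, Springer (1997), I §2.2 Proposition 8. [SerreGaloisCohomology1997]
* J. W. S. Cassels, A. Fröhlich (eds.), *Algebraic Number Theory* (1967), Ch. VII (J. Tate) §11.1. [CasselsFrohlichANT1967]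
-/

noncomputable section


open NumberField CategoryTheory groupCohomology
open Field (absoluteGaloisGroup)
open Literature.NumberTheory.Automorphic Literature.NumberTheory.Automorphic.IdeleClassGroup
open Literature.NumberTheory.NumberFields
open Literature.Algebra.Homology
open scoped Classical

namespace Literature.NumberTheory.GaloisRepresentations

namespace IdeleClassBar

variable {F : Type} [Field F] [NumberField F]

/-! ## §7. The dictionary: finite Galois layers `E ⊆ F̄` ↔ open normal subgroups of `Γ_F` -/

namespace GalLayer

omit [NumberField F] in
/-- `U_E = Gal(F̄/E)` is a normal subgroup of `Γ_F` (`E/F` Galois: it is the kernel of `σ ↦ σ|_E`).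
[cite: SerreGaloisCohomology1997, I §2.2] -/
theorem fixingSubgroup_normal (E : GalLayer F) :
    (E.1.fixingSubgroup : Subgroup (absoluteGaloisGroup F)).Normal := by
  haveI := E.isGalois
  have h := MonoidHom.normal_ker (AlgEquiv.restrictNormalHom (F := F) (K₁ := AlgebraicClosure F) E.1)
  rwa [IntermediateField.restrictNormalHom_ker] at h

/-- **The open normal subgroup `U_E = Gal(F̄/E)` of `Γ_F`** attached to a layer (open by Mathlib's Krull topology,
`IntermediateField.fixingSubgroup_isOpen`; as a subgroup it is door-c4's `DiscreteRep.galSubgroup E`).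
[cite: SerreGaloisCohomology1997, I §2.2] -/
def openNormalSubgroup (E : GalLayer F) : OpenNormalSubgroup (absoluteGaloisGroup F) where
  toSubgroup := E.1.fixingSubgroup
  isOpen' := by
    haveI := E.finiteDimensional
    exact E.1.fixingSubgroup_isOpen
  isNormal' := E.fixingSubgroup_normal

omit [NumberField F] in
/-- `U_E = Gal(F̄/E)` as a subgroup. [cite: SerreGaloisCohomology1997, I §2.2] -/
theorem coe_openNormalSubgroup (E : GalLayer F) :
    (E.openNormalSubgroup : Subgroup (absoluteGaloisGroup F)) = E.1.fixingSubgroup := rfl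

omit [NumberField F] in
/-- Membership in `U_E`: `σ ∈ Gal(F̄/E)`. [cite: SerreGaloisCohomology1997, I §2.2] -/
theorem mem_openNormalSubgroup_iff (E : GalLayer F) (σ : absoluteGaloisGroup F) :
    σ ∈ E.openNormalSubgroup ↔ σ ∈ E.1.fixingSubgroup := Iff.rfl

/-- **The dictionary reverses inclusions: `U_{E'} ≤ U_E ↔ E ≤ E'`** (Galois correspondence for `F̄/F`, which is
Galois in characteristic zero: `F̄^{U_E} = E`). [cite: SerreGaloisCohomology1997, I §2.2] -/
theorem openNormalSubgroup_le_iff {E E' : GalLayer F} : E'.openNormalSubgroup ≤ E.openNormalSubgroup ↔ E ≤ E' := by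
  change E'.1.fixingSubgroup ≤ E.1.fixingSubgroup ↔ E.1 ≤ E'.1
  conv_rhs => rw [← InfiniteGalois.fixedField_fixingSubgroup E'.1]
  exact (IntermediateField.le_iff_le _ _).symm

omit [NumberField F] in
/-- `E ≤ E' → U_{E'} ≤ U_E` as subgroups of `Γ_F`. [cite: SerreGaloisCohomology1997, I §2.2] -/
theorem coe_openNormalSubgroup_le {E E' : GalLayer F} (h : E ≤ E') :
    (E'.openNormalSubgroup : Subgroup (absoluteGaloisGroup F)) ≤ E.openNormalSubgroup :=
  IntermediateField.fixingSubgroup_le h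

/-- **The layer `F̄^U` of an open normal subgroup `U ≤ Γ_F`**: finite (`U` open, Mathlib
`InfiniteGalois.isOpen_iff_finite`) and Galois (`U` normal, `IsGalois.of_fixedField_normal_subgroup`) over `F`.
[cite: SerreGaloisCohomology1997, I §2.2] -/
def ofOpenNormalSubgroup (U : OpenNormalSubgroup (absoluteGaloisGroup F)) : GalLayer F :=
  ⟨IntermediateField.fixedField (U : Subgroup (absoluteGaloisGroup F)),
    (InfiniteGalois.isOpen_iff_finite _).1 (by
      rw [InfiniteGalois.fixingSubgroup_fixedField
        ⟨(U : Subgroup (absoluteGaloisGroup F)), U.toOpenSubgroup.isClosed⟩]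
      exact U.toOpenSubgroup.isOpen),
    IsGalois.of_fixedField_normal_subgroup (U : Subgroup (absoluteGaloisGroup F))⟩

/-- `(ofOpenNormalSubgroup U).1 = F̄^U`. [cite: SerreGaloisCohomology1997, I §2.2] -/
theorem ofOpenNormalSubgroup_val (U : OpenNormalSubgroup (absoluteGaloisGroup F)) :
    (ofOpenNormalSubgroup U).1 = IntermediateField.fixedField (U : Subgroup (absoluteGaloisGroup F)) := rfl

/-- `U_{F̄^U} = U`. [cite: SerreGaloisCohomology1997, I §2.2] -/
theorem openNormalSubgroup_ofOpenNormalSubgroup (U : OpenNormalSubgroup (absoluteGaloisGroup F)) :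
    (ofOpenNormalSubgroup U).openNormalSubgroup = U := by
  apply OpenNormalSubgroup.toSubgroup_injective
  exact InfiniteGalois.fixingSubgroup_fixedField
    ⟨(U : Subgroup (absoluteGaloisGroup F)), U.toOpenSubgroup.isClosed⟩

/-- `F̄^{U_E} = E`. [cite: SerreGaloisCohomology1997, I §2.2] -/
theorem ofOpenNormalSubgroup_openNormalSubgroup (E : GalLayer F) : ofOpenNormalSubgroup E.openNormalSubgroup = E :=
  Subtype.ext (InfiniteGalois.fixedField_fixingSubgroup E.1)

variable (F) in
/-- **The finite Galois layers of `F̄/F` and the open normal subgroups of `Γ_F` are in order-reversing bijection**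
`E ↦ U_E = Gal(F̄/E)`, `U ↦ F̄^U` (so door-c4's system indexed by `OpenNormalSubgroup Γ_F` and the cell's system
indexed by `GalLayer F` are re-indexings of each other). [cite: SerreGaloisCohomology1997, I §2.2] -/
def layerEquivOpenNormalSubgroup : GalLayer F ≃o (OpenNormalSubgroup (absoluteGaloisGroup F))ᵒᵈ where
  toFun E := OrderDual.toDual E.openNormalSubgroup
  invFun U := ofOpenNormalSubgroup (OrderDual.ofDual U)
  left_inv := ofOpenNormalSubgroup_openNormalSubgroup
  right_inv U := congrArg OrderDual.toDual (openNormalSubgroup_ofOpenNormalSubgroup (OrderDual.ofDual U))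
  map_rel_iff' := openNormalSubgroup_le_iff

/-- Formula for the order isomorphism. [cite: SerreGaloisCohomology1997, I §2.2] -/
theorem layerEquivOpenNormalSubgroup_apply (E : GalLayer F) :
    layerEquivOpenNormalSubgroup F E = OrderDual.toDual E.openNormalSubgroup := rfl

/-- Formula for the inverse order isomorphism. [cite: SerreGaloisCohomology1997, I §2.2] -/
theorem layerEquivOpenNormalSubgroup_symm_apply (U : (OpenNormalSubgroup (absoluteGaloisGroup F))ᵒᵈ) :
    (layerEquivOpenNormalSubgroup F).symm U = ofOpenNormalSubgroup (OrderDual.ofDual U) := rfl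

omit [NumberField F] in
/-- **`Γ_F ⧸ U_E ≃* Gal(E/F)`**, `[σ] ↦ σ|_E` (`σ ↦ σ|_E` is onto with kernel `Gal(F̄/E)`; Mathlib
`QuotientGroup.liftEquiv`, `AlgEquiv.restrictNormalHom_surjective`, `IntermediateField.restrictNormalHom_ker`).
[cite: SerreGaloisCohomology1997, I §2.2] -/
def quotEquiv (E : GalLayer F) :
    absoluteGaloisGroup F ⧸ (E.openNormalSubgroup : Subgroup (absoluteGaloisGroup F)) ≃* (E.1 ≃ₐ[F] E.1) :=
  haveI := E.isGalois
  QuotientGroup.liftEquiv _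
    (AlgEquiv.restrictNormalHom_surjective (F := F) (K₁ := E.1) (E := AlgebraicClosure F))
    (IntermediateField.restrictNormalHom_ker E.1).symm

/-- `quotEquiv [σ] = σ|_E`. [cite: SerreGaloisCohomology1997, I §2.2] -/
theorem quotEquiv_mk (E : GalLayer F) (σ : absoluteGaloisGroup F) :
    E.quotEquiv (QuotientGroup.mk σ) = (haveI := E.isGalois; σ.restrictNormal E.1) := rfl

/-- `quotEquiv⁻¹ (σ|_E) = [σ]`. [cite: SerreGaloisCohomology1997, I §2.2] -/
theorem quotEquiv_symm_restrictNormal (E : GalLayer F) (σ : absoluteGaloisGroup F) :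
    E.quotEquiv.symm (haveI := E.isGalois; σ.restrictNormal E.1) = QuotientGroup.mk σ := by
  rw [MulEquiv.symm_apply_eq, quotEquiv_mk]

end GalLayer

/-! ## §8. `C̄` as an object of the category `C_Γ` of discrete `Γ_F`-modules, and its layer objects -/

variable (F)

/-- **`C̄` as an object of `Rep ℤ Γ_F`** (`Γ_F = absoluteGaloisGroup F`; the representation `barRep F` of g15).
[cite: Harari2020, §13.1] -/
abbrev classBarRep : Rep ℤ (absoluteGaloisGroup F) := Rep.of (barRep F)

/-- The action is `barRep`. [cite: Harari2020, §13.1] -/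
theorem classBarRep_ρ_apply (σ : absoluteGaloisGroup F) (z : classBar F) :
    (classBarRep F).ρ σ z = barRep F σ z := rfl

variable {F} in
/-- `Gal(F̄/E)` stabilises the image of `C_E`. [cite: Harari2020, §13.1] -/
theorem fixingSubgroup_le_stabilizer_ofLayer (E : GalLayer F) (x : layerClass F E) :
    (E.openNormalSubgroup : Subgroup (absoluteGaloisGroup F)) ≤
      DiscreteRep.stabilizer (classBarRep F) (ofLayer F E x) :=
  fun _ hσ => barRep_ofLayer_of_mem_fixingSubgroup E hσ x

/-- **`C̄` is a discrete `Γ_F`-module**: every stabiliser contains an open subgroup `Gal(F̄/E)`, hence is open.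
[cite: Harari2020, §4.2 Remark 4.13 and §13.1] -/
theorem isDiscrete_classBarRep : DiscreteRep.IsDiscrete (classBarRep F) := fun z => by
  obtain ⟨E, x, rfl⟩ := exists_ofLayer z
  exact Subgroup.isOpen_mono (fixingSubgroup_le_stabilizer_ofLayer E x) E.openNormalSubgroup.toOpenSubgroup.isOpen

/-- **`C̄` as an object of `C_Γ = DiscreteRepCat ℤ Γ_F`** (door-c4's abelian category of discrete representations).
[cite: Harari2020, §4.2 and §13.1] -/
abbrev classBarD : DiscreteRepCat ℤ (absoluteGaloisGroup F) :=
  DiscreteRep.mk (classBarRep F) (isDiscrete_classBarRep F)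

variable {F}

/-- **The layer object `C̄^{U_E}` of door-c4's system** (`(invariantsQuotFunctor ℤ U_E).obj (classBarD F)`, a
representation of `Γ_F ⧸ U_E`; an abbreviation, so that door-c4's `LExt`, `invariantsStepIncl`, `step` apply verbatim).
[cite: SerreGaloisCohomology1997, I §2.2 Proposition 8] -/
abbrev layerRep (E : GalLayer F) :
    Rep ℤ (absoluteGaloisGroup F ⧸ (E.openNormalSubgroup : Subgroup (absoluteGaloisGroup F))) :=
  (DiscreteRep.invariantsQuotFunctor ℤ (E.openNormalSubgroup : Subgroup (absoluteGaloisGroup F))).obj (classBarD F)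

/-- The underlying vector of `[σ] • z` in the layer `C̄^{U_E}` is `σ • z`. [cite: Harari2020, §13.1] -/
theorem coe_layerRep_ρ_mk (E : GalLayer F) (σ : absoluteGaloisGroup F) (z : (layerRep E).V) :
    (((layerRep E).ρ (QuotientGroup.mk σ) z).1 : classBar F) = barRep F σ (z.1 : classBar F) := rfl

/-! ## §9. The layer module `C̄^{U_E} ≅ C_E` -/

/-- **`C̄^{U_E}` is the image of `C_E`** (g15 `setOf_forall_mem_fixingSubgroup_eq_range`, in `Representation.invariants`
form for the restriction of `classBarRep` to `U_E`). [cite: Harari2020, §13.1] -/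
theorem mem_invariants_iff (E : GalLayer F) (z : classBar F) :
    z ∈ Representation.invariants
        ((classBarRep F).ρ.comp (E.openNormalSubgroup : Subgroup (absoluteGaloisGroup F)).subtype) ↔
      z ∈ Set.range (ofLayer F E) := by
  rw [← setOf_forall_mem_fixingSubgroup_eq_range, Representation.mem_invariants, Set.mem_setOf_eq]
  constructor
  · intro h σ hσ
    exact h ⟨σ, hσ⟩
  · intro h g
    exact h g.1 g.2

/-- `C_E → C̄^{U_E}`, `x ↦ [x]`. [cite: Harari2020, §13.1] -/
def toInvariantsHom (E : GalLayer F) : layerClass F E →+ (layerRep E).V :=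
  AddMonoidHom.mk' (fun x => ⟨ofLayer F E x, (mem_invariants_iff E _).2 ⟨x, rfl⟩⟩) fun x y =>
    Subtype.ext (map_add (ofLayer F E) x y)

/-- Formula. [cite: Harari2020, §13.1] -/
theorem coe_toInvariantsHom (E : GalLayer F) (x : layerClass F E) :
    ((toInvariantsHom E x).1 : classBar F) = ofLayer F E x := rfl

/-- `C_E → C̄^{U_E}` is bijective. [cite: Harari2020, §13.1] -/
theorem toInvariantsHom_bijective (E : GalLayer F) : Function.Bijective (toInvariantsHom E) := by
  refine ⟨fun x y hxy => ofLayer_injective E (congrArg Subtype.val hxy), fun z => ?_⟩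
  obtain ⟨x, hx⟩ := (mem_invariants_iff E z.1).1 z.2
  exact ⟨x, Subtype.ext hx⟩

/-- **The layer module: `C̄^{U_E} ≃ₗ[ℤ] C_E`** (inverse of `x ↦ [x]`; the `ℤ`-module structures are the ones
carried by the two `Rep` objects, so that Mathlib's `groupCohomology.mapIso` applies verbatim). [cite: Harari2020, §13.1] -/
def layerEquiv (E : GalLayer F) :
    letI := (layerRep E).hV2
    letI := (haveI := E.numberField; IdeleClassGroup.galoisRep F E.1).hV2
    (layerRep E).V ≃ₗ[ℤ] layerClass F E :=
  { (AddEquiv.ofBijective (toInvariantsHom E) (toInvariantsHom_bijective E)).symm with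
    map_smul' := fun c z => by
      let e := (AddEquiv.ofBijective (toInvariantsHom E) (toInvariantsHom_bijective E)).symm
      change e (c • z) = c • e z
      induction c using Int.induction_on with
      | zero => rw [zero_smul, zero_smul, map_zero]
      | succ n ih => rw [add_smul, add_smul, one_smul, one_smul, map_add, ih]
      | pred n ih => rw [sub_smul, sub_smul, one_smul, one_smul, map_sub, ih] }

/-- `layerEquiv⁻¹ x = [x]`. [cite: Harari2020, §13.1] -/
theorem layerEquiv_symm_apply (E : GalLayer F) (x : layerClass F E) :
    (layerEquiv E).symm x = toInvariantsHom E x :=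
  (layerEquiv E).symm_apply_eq.2
    ((AddEquiv.ofBijective (toInvariantsHom E) (toInvariantsHom_bijective E)).symm_apply_apply x).symm

/-- `layerEquiv⁻¹ x = [x]` on underlying vectors. [cite: Harari2020, §13.1] -/
theorem coe_layerEquiv_symm (E : GalLayer F) (x : layerClass F E) :
    (((layerEquiv E).symm x).1 : classBar F) = ofLayer F E x := by
  rw [layerEquiv_symm_apply, coe_toInvariantsHom]

/-- `[layerEquiv z] = z`. [cite: Harari2020, §13.1] -/
theorem ofLayer_layerEquiv (E : GalLayer F) (z : (layerRep E).V) :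
    ofLayer F E (layerEquiv E z) = (z.1 : classBar F) := by
  rw [← coe_layerEquiv_symm, LinearEquiv.symm_apply_apply]

/-- `layerEquiv z = x ↔ z = [x]`. [cite: Harari2020, §13.1] -/
theorem layerEquiv_eq_iff (E : GalLayer F) (z : (layerRep E).V) (x : layerClass F E) :
    layerEquiv E z = x ↔ (z.1 : classBar F) = ofLayer F E x := by
  constructor
  · rintro rfl
    exact (ofLayer_layerEquiv E z).symm
  · intro h
    exact ofLayer_injective E ((ofLayer_layerEquiv E z).trans h)

/-- **Equivariance**: `layerEquiv ([σ] • z) = σ|_E • layerEquiv z`. [cite: Harari2020, §13.1] -/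
theorem layerEquiv_ρ_mk (E : GalLayer F) (σ : absoluteGaloisGroup F) (z : (layerRep E).V) :
    layerEquiv E ((layerRep E).ρ (QuotientGroup.mk σ) z) = layerAct F E σ (layerEquiv E z) := by
  rw [layerEquiv_eq_iff, coe_layerRep_ρ_mk, ← ofLayer_layerEquiv E z, barRep_ofLayer]

/-- **`layerEquiv` intertwines the `Γ_F ⧸ U_E`-action on `C̄^{U_E}` with the `Gal(E/F)`-action on `C_E` along
`quotEquiv`.** [cite: Harari2020, §13.1] -/
theorem layerEquiv_comm (E : GalLayer F)
    (g : absoluteGaloisGroup F ⧸ (E.openNormalSubgroup : Subgroup (absoluteGaloisGroup F))) :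
    (layerEquiv E).toLinearMap ∘ₗ (layerRep E).ρ g =
      (haveI := E.numberField; IdeleClassGroup.galoisRep F E.1).ρ (E.quotEquiv g) ∘ₗ (layerEquiv E).toLinearMap := by
  haveI := E.numberField
  induction g using QuotientGroup.induction_on with
  | H σ =>
    refine LinearMap.ext fun z => ?_
    change layerEquiv E ((layerRep E).ρ (QuotientGroup.mk σ) z) =
      (IdeleClassGroup.galoisRep F E.1).ρ (E.quotEquiv (QuotientGroup.mk σ)) (layerEquiv E z)
    rw [layerEquiv_ρ_mk, GalLayer.quotEquiv_mk]
    rfl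

/-- **The inclusion `C̄^{U_E} ⊆ C̄^{U_{E'}}` of door-c4's system is the transition map `C_E → C_{E'}`** of g15's
directed system, under the `layerEquiv`s. [cite: Harari2020, §13.1] -/
theorem layerEquiv_invariantsStepIncl {E E' : GalLayer F} (h : E ≤ E') (z : (layerRep E).V) :
    layerEquiv E' ((DiscreteRep.invariantsStepIncl (E.openNormalSubgroup : Subgroup (absoluteGaloisGroup F))
        (E'.openNormalSubgroup : Subgroup (absoluteGaloisGroup F)) (GalLayer.coe_openNormalSubgroup_le h)
        (classBarD F)).hom z) =
      transHom E E' h (layerEquiv E z) := by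
  rw [layerEquiv_eq_iff, DiscreteRep.invariantsStepIncl_hom_apply_coe, ofLayer_transHom]
  exact (ofLayer_layerEquiv E z).symm

/-! ## §10. `Hⁿ(Γ_F ⧸ U_E, C̄^{U_E}) ≅ Hⁿ(Gal(E/F), C_E)` -/

/-- **The layers of `C̄` have the cohomology of the idèle class formation:
`Hⁿ(Γ_F ⧸ U_E, C̄^{U_E}) ≅ Hⁿ(Gal(E/F), C_E)`** (Mathlib `groupCohomology.mapIso` along `quotEquiv`, `layerEquiv`).
[cite: SerreGaloisCohomology1997, I §2.2 Proposition 8] -/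
def layerCohomologyIso (E : GalLayer F) (n : ℕ) :
    groupCohomology (layerRep E) n ≅ groupCohomology (haveI := E.numberField; IdeleClassGroup.galoisRep F E.1) n :=
  haveI := E.numberField
  groupCohomology.mapIso E.quotEquiv (layerEquiv E) (layerEquiv_comm E) n

end IdeleClassBar

end Literature.NumberTheory.GaloisRepresentations

end
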